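import Summits.BirchSwinnertonDyer.BirchSwinnertonDyer.Theorems.KolyvaginRoadThreeSchneiderTamAtThreeHeightLogNumeratorExactProduct
import HarnessLib

/-!
# «The height is the logarithm of the numerator» — the EXACT second-order law at EVERY multiplicative
# prime `p ≥ 5`, part 3a: the Lambert series and the sigma product to all orders in `q`, in `ℚ_p`

HONEST FRAMING (cell `bsd-stepL`, seat `bsd-stepL-tam3-p2` g5, WIDTH-LEVER second lane «closed-form Schneider
local factor … by Kodaira type (finite case table proved once)»; `--supports stmt-BirchSwinnertonDyer-19154 --as helper`):
THEOREMS ONLY, unconditional, route-independent (no Theses import); 0 definitions, 0 named facts, 0 sorry;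
nothing here proves the crux `SchneiderTamAtThree`, Schneider's conjecture or BSD. `p`-generic twins of part 7a
(`…ExactProduct`, g3, stated in `ℚ₃`): the Lambert form of `s₁`, the product
`Π = ∏(1 − 2qⁿc + q²ⁿ)²/(1 − qⁿ)⁴ = 1 − 4(c−1)s₁(q) + O(q²(c−1)²)` and the bookkeeping `exact_logPr`; the proofs are
the `p = 3` proofs verbatim with `3 ↦ p` (the `cosh` input enters in its `p ≥ 5` form `‖2(c−1) − L‖ ≤ ‖L‖²`).

* `tateS_one_eq_tsum_lambert_padic`, `norm_lambert_term_le_padic`, `hasSum_lambert_one_padic`;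
* `multipliable_tateSigmaSq_factor_padic`, `norm_tprod_tateSigmaSq_factor_sub_lambert_le_padic`
  (`‖Π − (1 − 4(c−1)s₁)‖ ≤ ‖q‖²‖c−1‖²`); `exact_logPr_padic` (`‖log_p Π + 2s₁·L‖ ≤ r⁴`).

References: [SteinWuthrich2013] §4.2; [SilvermanATAEC1994] V.1 Rem. 1.2, V.3; tree: g3 `…ExactProduct`, g0 `…Series` part 1
(`norm_tateSigmaSq_factor_sub_one_le_mul`, any `p`), Literature `TateCurve/UniformizationAnnulus` (`tsum_pnat_tateXTerm`).
-/

noncomputable section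

open scoped Classical Nat
open Filter Topology IsUltrametricDist PowerSeries
open WeierstrassCurve Literature.NumberTheory.EllipticCurves
open Literature.NumberTheory.EllipticCurves.SteinWuthrich2013
open Literature.NumberTheory.EllipticCurves.TateCurve
open Literature.NumberTheory.EllipticCurves.Rank1Residual
open Summit.BirchSwinnertonDyer.Uniform.UI.O2

namespace Summit.BirchSwinnertonDyer.Rank1Residual.X11b.RegMult.HeightLogNumerator

variable {p : ℕ} [hp : Fact p.Prime]

/-! ### §9 The Lambert series and the sigma product to all orders in `q`, in `ℚ_p` -/

section Lambert

/-- **Lambert form of `s₁`** in `ℚ_p`: for `‖q‖_p < 1`, `s₁(q) = Σ_{n≥1} σ₁(n)qⁿ = Σ_{n≥1} qⁿ/(1 − qⁿ)²`.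
[cite: SilvermanATAEC1994, Remark V.1.2 (PDF p. 386) and Thm. V.3.1 (c)] -/
theorem tateS_one_eq_tsum_lambert_padic {q : ℚ_[p]} (hq : ‖q‖ < 1) :
    tateS 1 q = ∑' n : ℕ, q ^ (n + 1) / (1 - q ^ (n + 1)) ^ 2 := by
  have hq1 : ‖q * 1‖ < 1 := by rwa [mul_one]
  rw [tateS_one_eq_tsum_pnat, ← tsum_pnat_tateXTerm hq hq1,
    ← tsum_pnat_eq_tsum_succ (f := fun n : ℕ ↦ q ^ n / (1 - q ^ n) ^ 2)]
  refine tsum_congr fun n ↦ ?_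
  rw [tateXTerm, zpow_natCast, mul_one]

/-- Termwise `‖qⁿ⁺¹/(1 − qⁿ⁺¹)²‖ = ‖q‖ⁿ⁺¹ ≤ ‖q‖` for `‖q‖_p < 1`. [folklore] -/
theorem norm_lambert_term_le_padic {q : ℚ_[p]} (hq : ‖q‖ < 1) (n : ℕ) :
    ‖q ^ (n + 1) / (1 - q ^ (n + 1)) ^ 2‖ = ‖q‖ ^ (n + 1) ∧ ‖q ^ (n + 1) / (1 - q ^ (n + 1)) ^ 2‖ ≤ ‖q‖ := by
  have hqn : ‖q ^ (n + 1)‖ < 1 := by rw [norm_pow]; exact pow_lt_one₀ (norm_nonneg _) hq (by omega)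
  have h1 : ‖q ^ (n + 1) / (1 - q ^ (n + 1)) ^ 2‖ = ‖q‖ ^ (n + 1) := by
    rw [norm_div, norm_pow (1 - q ^ (n + 1)), norm_one_sub_eq_one hqn, one_pow, div_one, norm_pow]
  refine ⟨h1, ?_⟩
  rw [h1, pow_succ]
  exact mul_le_of_le_one_left (norm_nonneg _) (pow_le_one₀ (norm_nonneg _) hq.le)

/-- `HasSum (n ↦ qⁿ⁺¹/(1 − qⁿ⁺¹)²) (s₁(q))` in `ℚ_p` for `‖q‖_p < 1`. [cite: SilvermanATAEC1994, Remark V.1.2] -/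
theorem hasSum_lambert_one_padic {q : ℚ_[p]} (hq : ‖q‖ < 1) :
    HasSum (fun n : ℕ ↦ q ^ (n + 1) / (1 - q ^ (n + 1)) ^ 2) (tateS 1 q) := by
  rw [tateS_one_eq_tsum_lambert_padic hq]
  refine (Summable.of_norm_bounded ((summable_geometric_of_lt_one (norm_nonneg q) hq).mul_left ‖q‖)
    fun n ↦ ?_).hasSum
  rw [(norm_lambert_term_le_padic hq n).1, pow_succ, mul_comm]

/-- The sigma factors are multipliable in `ℚ_p` for `‖q‖ < 1`, `‖c‖ ≤ 1` (geometric majorant of `‖f_n − 1‖`, from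
part 1 of the `p = 3` chain `norm_tateSigmaSq_factor_sub_one_le_mul` at the base `qⁿ⁺¹`). [folklore] -/
theorem multipliable_tateSigmaSq_factor_padic {q c : ℚ_[p]} (hq : ‖q‖ < 1) (hc : ‖c‖ ≤ 1) :
    Multipliable fun n : ℕ ↦ (1 - 2 * q ^ (n + 1) * c + q ^ (2 * (n + 1))) ^ 2 / (1 - q ^ (n + 1)) ^ 4 := by
  have heq : (fun n : ℕ ↦ (1 - 2 * q ^ (n + 1) * c + q ^ (2 * (n + 1))) ^ 2 / (1 - q ^ (n + 1)) ^ 4) =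
      fun n : ℕ ↦ 1 + ((1 - 2 * q ^ (n + 1) * c + q ^ (2 * (n + 1))) ^ 2 / (1 - q ^ (n + 1)) ^ 4 - 1) := by
    funext n; ring
  rw [heq]
  refine multipliable_one_add_of_summable ?_
  refine Summable.of_nonneg_of_le (fun _ ↦ norm_nonneg _) (fun n ↦ ?_)
    (((summable_geometric_of_lt_one (norm_nonneg q) hq).mul_right ‖q‖).mul_right ‖c - 1‖)
  have hqn : ‖q ^ (n + 1)‖ < 1 := by rw [norm_pow]; exact pow_lt_one₀ (norm_nonneg _) hq (by omega)
  have h := norm_tateSigmaSq_factor_sub_one_le_mul (q := q ^ (n + 1)) hqn hc 0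
  rw [zero_add, pow_one, show 2 * 1 = 2 from rfl, ← pow_mul, show (n + 1) * 2 = 2 * (n + 1) by ring] at h
  refine h.trans (le_of_eq ?_)
  rw [norm_pow, pow_succ]

/-- **The sigma product to first order in `c − 1`, ALL orders in `q`, in `ℚ_p`**: for `‖q‖_p < 1`, `‖c‖_p ≤ 1`,
`‖∏_{n≥1} (1 − 2qⁿc + q²ⁿ)²/(1 − qⁿ)⁴ − (1 − 4(c − 1)·s₁(q))‖ ≤ ‖q‖²·‖c − 1‖²` (the finite version of part 7a,
whose proof is prime-independent, is re-run here at `p`; limits `HasProd`/`HasSum`). [cite: SteinWuthrich2013, §4.2] -/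
theorem norm_tprod_tateSigmaSq_factor_sub_lambert_le_padic {q c : ℚ_[p]} (hq : ‖q‖ < 1) (hc : ‖c‖ ≤ 1) :
    ‖(∏' n : ℕ, (1 - 2 * q ^ (n + 1) * c + q ^ (2 * (n + 1))) ^ 2 / (1 - q ^ (n + 1)) ^ 4) -
        (1 - 4 * (c - 1) * tateS 1 q)‖ ≤ ‖q‖ ^ 2 * ‖c - 1‖ ^ 2 := by
  classical
  -- finite version
  have hfin : ∀ s : Finset ℕ,
      ‖∏ n ∈ s, (1 - 2 * q ^ (n + 1) * c + q ^ (2 * (n + 1))) ^ 2 / (1 - q ^ (n + 1)) ^ 4 -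
          (1 - 4 * (c - 1) * ∑ n ∈ s, q ^ (n + 1) / (1 - q ^ (n + 1)) ^ 2)‖ ≤ ‖q‖ ^ 2 * ‖c - 1‖ ^ 2 := by
    set g : ℕ → ℚ_[p] := fun n ↦ q ^ (n + 1) / (1 - q ^ (n + 1)) ^ 2 with hg
    set f : ℕ → ℚ_[p] := fun n ↦ (1 - 2 * q ^ (n + 1) * c + q ^ (2 * (n + 1))) ^ 2 / (1 - q ^ (n + 1)) ^ 4
      with hf
    have hfg : ∀ n, f n = (1 - 2 * (c - 1) * g n) ^ 2 := fun n ↦ by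
      have hqn : ‖q ^ (n + 1)‖ < 1 := by rw [norm_pow]; exact pow_lt_one₀ (norm_nonneg _) hq (by omega)
      have hB : ‖1 - q ^ (n + 1)‖ = 1 := norm_one_sub_eq_one hqn
      have hB0 : (1 - q ^ (n + 1)) ≠ 0 := by intro h; rw [h, norm_zero] at hB; exact zero_ne_one hB
      simp only [hf, hg]
      rw [show q ^ (2 * (n + 1)) = (q ^ (n + 1)) ^ 2 by rw [← pow_mul, mul_comm]]
      field_simp
      ring
    have hgn : ∀ n, ‖g n‖ ≤ ‖q‖ := fun n ↦ (norm_lambert_term_le_padic hq n).2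
    have h4 : ‖(4 : ℚ_[p])‖ ≤ 1 := by
      rw [show (4 : ℚ_[p]) = ((4 : ℤ) : ℚ_[p]) by norm_cast]; exact Padic.norm_int_le_one _
    have h2 : ‖(2 : ℚ_[p])‖ ≤ 1 := by
      rw [show (2 : ℚ_[p]) = ((2 : ℤ) : ℚ_[p]) by norm_cast]; exact Padic.norm_int_le_one _
    have hB0 : 0 ≤ ‖q‖ ^ 2 * ‖c - 1‖ ^ 2 := by positivity
    intro s
    show ‖∏ n ∈ s, f n - (1 - 4 * (c - 1) * ∑ n ∈ s, g n)‖ ≤ ‖q‖ ^ 2 * ‖c - 1‖ ^ 2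
    induction s using Finset.induction_on with
    | empty => simpa using hB0
    | insert a s ha ih =>
      rw [Finset.prod_insert ha, Finset.sum_insert ha]
      set P := ∏ n ∈ s, f n with hP
      set G := ∑ n ∈ s, g n with hG
      have hGn : ‖G‖ ≤ ‖q‖ := IsUltrametricDist.norm_sum_le_of_forall_le_of_nonneg (norm_nonneg q)
        fun n _ ↦ hgn n
      have hfa1 : ‖f a‖ ≤ 1 := by
        rw [hfg a, norm_pow]
        refine pow_le_one₀ (norm_nonneg _) ((norm_sub_le_max₃ _ _).trans (max_le (by rw [norm_one]) ?_))
        rw [norm_mul, norm_mul]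
        calc ‖(2 : ℚ_[p])‖ * ‖c - 1‖ * ‖g a‖ ≤ 1 * 1 * ‖q‖ := by
              gcongr
              · exact (norm_sub_le_max₃ c 1).trans (max_le hc (by rw [norm_one]))
              · exact hgn a
          _ ≤ 1 * 1 * 1 := by gcongr
          _ = 1 := by norm_num
      have e : f a * P - (1 - 4 * (c - 1) * (g a + G)) =
          f a * (P - (1 - 4 * (c - 1) * G)) + 4 * (c - 1) ^ 2 * g a * (4 * G + g a - 4 * (c - 1) * g a * G) := by
        rw [hfg a]; ring
      rw [e]
      refine (norm_add_le_max _ _).trans (max_le ?_ ?_)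
      · rw [norm_mul]
        calc ‖f a‖ * ‖P - (1 - 4 * (c - 1) * G)‖ ≤ 1 * (‖q‖ ^ 2 * ‖c - 1‖ ^ 2) := by gcongr
          _ = ‖q‖ ^ 2 * ‖c - 1‖ ^ 2 := one_mul _
      · have hc1 : ‖c - 1‖ ≤ 1 := (norm_sub_le_max₃ c 1).trans (max_le hc (by rw [norm_one]))
        have hin : ‖4 * G + g a - 4 * (c - 1) * g a * G‖ ≤ ‖q‖ := by
          refine (norm_sub_le_max₃ _ _).trans (max_le ((norm_add_le_max _ _).trans (max_le ?_ (hgn a))) ?_)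
          · rw [norm_mul]
            calc ‖(4 : ℚ_[p])‖ * ‖G‖ ≤ 1 * ‖q‖ := by gcongr
              _ = ‖q‖ := one_mul _
          · rw [norm_mul, norm_mul, norm_mul]
            calc ‖(4 : ℚ_[p])‖ * ‖c - 1‖ * ‖g a‖ * ‖G‖ ≤ 1 * 1 * ‖q‖ * ‖q‖ := by gcongr; exact hgn a
              _ = ‖q‖ * ‖q‖ := by ring
              _ ≤ ‖q‖ * 1 := by gcongr
              _ = ‖q‖ := mul_one _
        rw [norm_mul, norm_mul, norm_mul, norm_pow]
        calc ‖(4 : ℚ_[p])‖ * ‖c - 1‖ ^ 2 * ‖g a‖ * ‖4 * G + g a - 4 * (c - 1) * g a * G‖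
            ≤ 1 * ‖c - 1‖ ^ 2 * ‖q‖ * ‖q‖ := by gcongr; exact hgn a
          _ = ‖q‖ ^ 2 * ‖c - 1‖ ^ 2 := by ring
  -- limits
  have hP := (multipliable_tateSigmaSq_factor_padic hq hc).hasProd
  have hS := hasSum_lambert_one_padic hq
  have hT : Tendsto (fun s : Finset ℕ ↦ (1 : ℚ_[p]) - 4 * (c - 1) * ∑ n ∈ s, q ^ (n + 1) / (1 - q ^ (n + 1)) ^ 2)
      atTop (𝓝 (1 - 4 * (c - 1) * tateS 1 q)) :=
    tendsto_const_nhds.sub (hS.const_mul (4 * (c - 1)))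
  exact le_of_tendsto (hP.sub hT).norm (Filter.Eventually.of_forall hfin)

/-- **The logarithm of the sigma product, exactly in `q`, at any `p`: `‖log_p Π + 2 s₁·L‖ ≤ r⁴`.** Abstract
bookkeeping as in part 7a's `exact_logPr`, with the `p ≥ 5` form `‖2(c−1) − L‖ ≤ ‖L‖²` of the `cosh` input
(no factor `3`) and `‖q‖ ≤ 1`. [folklore] -/
theorem exact_logPr_padic {q c L K P : ℚ_[p]} {r : ℝ} (hq1 : ‖q‖ ≤ 1) (hLn : ‖L‖ = r ^ 2)
    (hK : ‖K‖ ≤ ‖q‖) (hc1 : ‖c - 1‖ ≤ ‖L‖)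
    (hPrK : ‖P - (1 - 4 * (c - 1) * K)‖ ≤ ‖q‖ ^ 2 * ‖c - 1‖ ^ 2)
    (hlogPr : ‖padicLog p P - (P - 1)‖ ≤ (‖q‖ * r ^ 2) ^ 2) (hcL : ‖2 * (c - 1) - L‖ ≤ ‖L‖ ^ 2) :
    ‖padicLog p P + 2 * K * L‖ ≤ r ^ 4 := by
  have h2n : ‖(2 : ℚ_[p])‖ ≤ 1 := by
    rw [show (2 : ℚ_[p]) = ((2 : ℤ) : ℚ_[p]) by norm_cast]; exact Padic.norm_int_le_one _
  have hq0 : 0 ≤ ‖q‖ := norm_nonneg _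
  have hr2 : 0 ≤ r ^ 2 := by rw [← hLn]; exact norm_nonneg _
  have e : padicLog p P + 2 * K * L =
      (padicLog p P - (P - 1)) + (P - (1 - 4 * (c - 1) * K)) - 2 * K * (2 * (c - 1) - L) := by ring
  rw [e]
  have hr4 : r ^ 4 = r ^ 2 * r ^ 2 := by ring
  refine (norm_sub_le_max₃ _ _).trans (max_le ((norm_add_le_max _ _).trans (max_le (hlogPr.trans ?_)
    (hPrK.trans ?_))) ?_)
  · rw [hr4]
    calc (‖q‖ * r ^ 2) ^ 2 = (‖q‖ * ‖q‖) * (r ^ 2 * r ^ 2) := by ring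
      _ ≤ (1 * 1) * (r ^ 2 * r ^ 2) := by gcongr
      _ = r ^ 2 * r ^ 2 := by ring
  · rw [hr4]
    calc ‖q‖ ^ 2 * ‖c - 1‖ ^ 2 ≤ 1 ^ 2 * ‖L‖ ^ 2 := by gcongr
      _ = r ^ 2 * r ^ 2 := by rw [hLn]; ring
  · rw [norm_mul, norm_mul]
    calc ‖(2 : ℚ_[p])‖ * ‖K‖ * ‖2 * (c - 1) - L‖ ≤ 1 * ‖q‖ * ‖L‖ ^ 2 := by gcongr
      _ ≤ 1 * 1 * ‖L‖ ^ 2 := by gcongr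
      _ = r ^ 4 := by rw [hLn]; ring

end Lambert

end Summit.BirchSwinnertonDyer.Rank1Residual.X11b.RegMult.HeightLogNumerator

end
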